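import Summits.HodgeConjecture.HodgeConjecture.Theorems.SoloInformedCurveNet
import Literature.AlgebraicGeometry.HodgeTheory.AlgebraicClassesPullbackDimLEThree
import HarnessLib

/-!
# An exact, unconditional criterion for the algebraicity of a single Hodge class on a fourfold
(solo seat `solo-HodgeConjecture-informed`, sixth landing)

The previous landings state EQUIVALENCES OF CONJECTURES (`HodgeConjecture ↔ C1 ↔ …`). This file
sharpens the first open case `(n, p) = (4, 2)` to statements about ONE class, with no hypothesis:

* `soloInformed_mem_algebraicClasses_of_mem_supportedClasses_one` — on a smooth projective complex
  variety of dimension `n ≤ 4`, a rational `(p,p)`-class of coniveau `≥ 1` IS ALGEBRAIC. (Deligne,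
  Hodge III 8.2.8, and the semisimplicity lift write a class dying off `Z ⊊ X` as `Σ g_* b` with `b`
  rational of type `(p-e, p-e)` on smooth projective `W` of dimension `n - e ≤ 3`, where the Hodge
  conjecture is a theorem of the tree, `hodgeClasses_algebraic_of_dim_le_three_holds`; Gysin images
  of algebraic classes are algebraic.) Hence `soloInformed_mem_algebraicClasses_iff_mem_supportedClasses_one`:
  for `1 ≤ p` and `dim X ≤ 4`, `c ∈ algebraicClasses X p ↔ c ∈ N¹ H²ᵖ(X(ℂ); ℂ)`.
* `soloInformed_mem_algebraicClasses_iff_curveNetSupport` — for a curve net `N` over `ℙ³`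
  (total space the smooth projective fourfold `X̃ = N.total`, net map `π : X̃ ⟶ ℙ³`) and a rational
  `(2,2)`-class `c` on `X̃`: **`c` is algebraic iff `c|_{(X̃ ∖ π⁻¹V(F))(ℂ)} = 0` for some nonzero
  admissible form `F`** — iff, in Saito's vocabulary (`soloInformed_mem_algebraicClasses_iff_rho_eq_zero`),
  `ρ_F c = 0` in the pure weight-`4` Hodge structure `(IH³(ℙ³, j_{!*}R¹π_*ℚ) ⊗ ℂ)/(IH³_{V(F)} ⊗ ℂ)`.
* `soloInformed_mem_algebraicClasses_iff_curveNetSupport_map` — for a smooth projective fourfold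
  `X`, ANY curve net `N` on `X` (one exists: `Motives.nonempty_curveNet_holds`) with blow-down
  `σ : X̃ ⟶ X`, and a rational `(2,2)`-class `c` on `X`: **`c` is algebraic iff `σ^* c` dies on
  `(X̃ ∖ π⁻¹V(F))(ℂ)` for some nonzero admissible `F`.** (`⇒`: `σ` is dominant, so `σ^* c` has
  coniveau `≥ 1` — `map_mem_supportedClasses_one_of_denseRange` — hence is algebraic by the first
  result, hence vertically supported, `soloInformed_curveNetSupport_of_mem_algebraicClasses`;
  `⇐`: `σ^* c` is algebraic by the first result and `c = σ_* σ^* c`,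
  `soloInformed_complexGysin_map_of_isBirational`, with `σ_*` preserving algebraic classes.)

So for fourfolds the Leray obstruction of the solo programme is EXACT class by class: writing
`U_F = ℙ³ ∖ V(F)` (affine, `π` smooth projective over it) and `ξ₁(c) ∈ H³(U_F, R¹π_*ℚ)` for the
Leray component of `σ^*c|_{π⁻¹U_F}` (the components in `H⁴(U_F, ℚ) = 0` and
`H²(U_F, R²π_*ℚ) ∋ (π_*σ^*c)|_{U_F} = 0` vanish for every `F` of degree `≥ 1`),

  **a rational `(2,2)`-class `c` on a smooth projective fourfold is algebraic
   iff `ξ₁(c) = 0` in `colim_F H³(ℙ³ ∖ V(F), R¹π_*ℚ) = H³(ℂ(ℙ³), H¹(C_η̄, ℚ))`,**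

the degree-`3` cohomology of the function field of `ℙ³` (cohomological dimension `3`) with values in
the `H¹` of the generic curve of the net. For `p = 1` the analogous class in `H¹` is the class of
the normal function of `c` and Jacobi inversion realises it by divisors on the curves (Lefschetz);
in degree `3` no inversion is known (Arapura 2022, Cor. 1.4 with `m = 3`, for a fixed fibration).

## References

* [GrothendieckTopology1969] A. Grothendieck, Hodge's general conjecture is false for trivial
  reasons, Topology 8 (1969) 299–303, §1 and footnote 2.
* [DeligneHodgeIII1974] P. Deligne, Théorie de Hodge III, Publ. Math. IHÉS 44 (1974), Cor. 8.2.8.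
* [Voisin2025] C. Voisin, Absolute Hodge classes and semisimplicity, 2025, Cor. 2.12.
* [VoisinHodgeII2003] C. Voisin, Hodge Theory and Complex Algebraic Geometry II (2003), proof of
  Prop. 10.26 (dimension `≤ 3`).
* [Arapura2022] D. Arapura, Hodge cycles and the Leray filtration, Pacific J. Math. 319 (2022),
  Thm. 1.2, Rem. 1.3, Cor. 1.4. arXiv:2103.05038.
* [Hartshorne1977] R. Hartshorne, Algebraic Geometry (1977), II Example 7.17.3.
* [Saito1990] M. Saito, Mixed Hodge modules, Publ. RIMS 26 (1990), Thm. 0.1–0.2.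
-/

noncomputable section

open CategoryTheory AlgebraicGeometry
open Literature.AlgebraicTopology.SingularHomology
open Literature.AlgebraicGeometry Literature.AlgebraicGeometry.HodgeTheory
open Literature.AlgebraicGeometry.Motives (CurveNet nonempty_curveNet_holds)

namespace Summit.HodgeConjecture.HodgeConjecture.Theorems

variable {n : ℕ} {X : Motives.SchemeOver ℂ}

/-! ### Coniveau `≥ 1` is algebraic in dimension `≤ 4`, class by class -/

/-- **On a smooth projective complex variety of dimension `≤ 4`, a rational `(p,p)`-class of
coniveau `≥ 1` is algebraic** (unconditional). A class dying off a closed `Z ⊊ X` is a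
`ℂ`-combination of Gysin images `g_* b`, `g : W → X`, `W` smooth projective of dimension
`n - e ≤ 3`, `1 ≤ e`, `b` rational of type `(p-e, p-e)` (Deligne 8.2.8 with the semisimplicity lift:
`mem_iSup_map_complexGysin_of_restrictCompl_eq_zero_of_ne_univ`, fed with the tree's discharges of
Deligne 8.2.8, Voisin's lift and projective Hironaka); `b` is algebraic because the Hodge conjecture
holds in dimension `≤ 3` (`hodgeClasses_algebraic_of_dim_le_three_holds`); and `g_*` preserves
algebraic classes (`map_complexGysin_algebraicClasses_le`).
[cite: GrothendieckTopology1969, §1] [cite: DeligneHodgeIII1974, Cor. 8.2.8]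
[cite: Voisin2025, Cor. 2.12] [cite: VoisinHodgeII2003, proof of Prop. 10.26] -/
theorem soloInformed_mem_algebraicClasses_of_mem_supportedClasses_one (hn : n ≤ 4)
    (hX : Motives.IsSmoothProjective n X) {p : ℕ} {c : complexBetti X (2 * p)}
    (hc : IsRationalClass c) (hc' : IsOfHodgeType n X (2 * p) p p c)
    (h1 : c ∈ supportedClasses X (2 * p) 1) : c ∈ algebraicClasses X p := by
  rcases Nat.eq_zero_or_pos p with rfl | hp
  · rw [algebraicClasses_zero]
    exact Submodule.mem_top
  -- `c` dies off one closed `Z ⊊ X`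
  obtain ⟨Z, hZ, hrZ, h0⟩ := exists_support_of_mem_supportedClasses h1
  have hZ' : Z ≠ Set.univ :=
    soloInformed_ne_univ_of_one_le_coheight hX fun z hz ↦ by exact_mod_cast hrZ z hz
  -- Deligne 8.2.8 + lifting of Hodge classes: `c = Σ g_* b`, `b` rational Hodge on `W`, `dim W ≤ 3`
  have hdec := mem_iSup_map_complexGysin_of_restrictCompl_eq_zero_of_ne_univ
    Deligne1974_ker_restrictCompl_eq_iSup_range_complexGysin_holds
    Voisin2025_hodgeClass_lift_complexGysin_holds Resolution.Hironaka1964_projective_holds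
    complexOrientationFamily hasPoincareDuality_complexOrientationFamily hX hZ hZ' hc hc' h0
  suffices hle : (⨆ (d : ℕ) (e : ℕ) (_ : d + e = p) (_ : 1 ≤ e) (W : Motives.SchemeOver ℂ) (m' : ℕ)
      (hm' : m' + e = n) (hW : Motives.IsSmoothProjective m' W) (g' : W ⟶ X),
      (Submodule.span ℂ {b : complexBetti W (2 * d) |
          IsRationalClass b ∧ IsOfHodgeType m' W (2 * d) d d b}).map
        (complexGysin complexOrientationFamily hW hX g'
          (show 2 * d + 2 * n = 2 * p + 2 * m' by omega))) ≤ algebraicClasses X p from hle hdec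
  refine iSup_le fun d ↦ iSup_le fun e ↦ iSup_le fun hde ↦ iSup_le fun he ↦ iSup_le fun W ↦
    iSup_le fun m' ↦ iSup_le fun hm' ↦ iSup_le fun hW ↦ iSup_le fun g' ↦ ?_
  subst hde
  refine le_trans (Submodule.map_mono ?_)
    (map_complexGysin_algebraicClasses_le (gysinMap_restrictCompl_eq_zero_of_field ℂ)
      complexOrientationFamily hasPoincareDuality_complexOrientationFamily hW hX g' hm')
  rw [Submodule.span_le]
  rintro b ⟨hb, hb'⟩
  -- the Hodge conjecture holds in dimension `m' ≤ 3`
  exact hodgeClasses_algebraic_of_dim_le_three_holds (by omega) hW d b hb hb'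

/-- **In dimension `≤ 4`, algebraic = coniveau `≥ 1`** for rational `(p,p)`-classes with `p ≥ 1`:
`c ∈ algebraicClasses X p ↔ c ∈ N¹ H²ᵖ(X(ℂ); ℂ)` (unconditional; `⇒` is `Nᵖ ⊆ N¹`).
[cite: GrothendieckTopology1969, §1] [cite: VoisinHodgeII2003, proof of Prop. 10.26] -/
theorem soloInformed_mem_algebraicClasses_iff_mem_supportedClasses_one (hn : n ≤ 4)
    (hX : Motives.IsSmoothProjective n X) {p : ℕ} (hp : 1 ≤ p) {c : complexBetti X (2 * p)}
    (hc : IsRationalClass c) (hc' : IsOfHodgeType n X (2 * p) p p c) :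
    c ∈ algebraicClasses X p ↔ c ∈ supportedClasses X (2 * p) 1 :=
  ⟨fun h ↦ supportedClasses_mono X (2 * p) hp h,
    soloInformed_mem_algebraicClasses_of_mem_supportedClasses_one hn hX hc hc'⟩

/-! ### The criterion on the total space of a curve net over `ℙ³` -/

/-- **Exact criterion on `X̃`.** For a curve net `N` over `ℙ³_ℂ` (total space the smooth projective
fourfold `X̃ = N.total`, net map `π : X̃ ⟶ ℙ³`) and a rational `(2,2)`-class `c ∈ H⁴(X̃(ℂ); ℂ)`:
`c` is algebraic iff `c|_{(X̃ ∖ π⁻¹V(F))(ℂ)} = 0` for some nonzero admissible form `F` (homogeneous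
of degree `≥ 1`, `Δ ⊆ V(F)`). `⇒`: `soloInformed_curveNetSupport_of_mem_algebraicClasses`.
`⇐`: such a class has coniveau `≥ 1` (`π` surjective, `V(F) ⊊ ℙ³` closed), hence is algebraic
(`soloInformed_mem_algebraicClasses_of_mem_supportedClasses_one`).
[cite: Arapura2022, Cor. 1.4] [cite: GrothendieckTopology1969, §1] -/
theorem soloInformed_mem_algebraicClasses_iff_curveNetSupport (N : CurveNet 3 X)
    (c : complexBetti N.total (2 * 2)) (hc : IsRationalClass c)
    (hc' : IsOfHodgeType (3 + 1) N.total (2 * 2) 2 2 c) :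
    c ∈ algebraicClasses N.total 2 ↔
      ∃ F : MvPolynomial (Fin (3 + 1)) ℂ, N.IsAdmissibleForm F ∧ F ≠ 0 ∧
        c ∈ classesSupportedOn N.total (N.proj.left.base ⁻¹' projHypersurface 3 F) (2 * 2) := by
  refine ⟨soloInformed_curveNetSupport_of_mem_algebraicClasses N le_rfl, fun ⟨F, _, hF0, hcF⟩ ↦ ?_⟩
  exact soloInformed_mem_algebraicClasses_of_mem_supportedClasses_one le_rfl N.isSmoothProjective_total
    hc hc' (soloInformed_coniveauOne_of_verticalSupport N.isSmoothProjective_total N.proj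
      N.surjective_proj (isClosed_projHypersurface 3 F) (projHypersurface_ne_univ 3 hF0)
      (mem_classesSupportedOn_iff.mp hcF))

/-- **The same in Saito's vocabulary.** For a curve net `N` over `ℙ³_ℂ`, a graded de Rham package
`K : CurveNetSaitoData N` (one exists: `curveNetSaitoData_nonempty_holds`) and a rational
`(2,2)`-class `c` on `X̃`: `c` is algebraic iff `ρ_F c = 0` in
`(IH³(ℙ³, j_{!*}R¹π_*ℚ) ⊗ ℂ)/(IH³_{V(F)} ⊗ ℂ)` for some nonzero admissible `F`.
[cite: Saito1990, Thm. 0.1–0.2] [cite: Arapura2022, Cor. 1.4] -/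
theorem soloInformed_mem_algebraicClasses_iff_rho_eq_zero (N : CurveNet 3 X)
    (K : CurveNetSaitoData N) (c : complexBetti N.total (3 + 1)) (hc : IsRationalClass c)
    (hc' : IsOfHodgeType (3 + 1) N.total (2 * 2) 2 2 c) :
    c ∈ algebraicClasses N.total 2 ↔
      ∃ F : MvPolynomial (Fin (3 + 1)) ℂ, N.IsAdmissibleForm F ∧ F ≠ 0 ∧ K.rho F c = 0 := by
  rw [soloInformed_mem_algebraicClasses_iff_curveNetSupport N c hc hc']
  refine ⟨fun ⟨F, hF, hF0, hcF⟩ ↦ ⟨F, hF, hF0, (K.rho_eq_zero_iff hF c).mpr hcF⟩,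
    fun ⟨F, hF, hF0, hcF⟩ ↦ ⟨F, hF, hF0, (K.rho_eq_zero_iff hF c).mp hcF⟩⟩

/-! ### The criterion on the fourfold itself, through any of its curve nets -/

/-- **Exact criterion on `X`.** Let `X` be a smooth projective complex fourfold, `N` ANY curve net
on `X` (blow-down `σ : X̃ ⟶ X`, net map `π : X̃ ⟶ ℙ³`; one exists by
`Motives.nonempty_curveNet_holds`), and `c ∈ H⁴(X(ℂ); ℂ)` a rational `(2,2)`-class. Then `c` is
algebraic iff `σ^* c` dies on `(X̃ ∖ π⁻¹V(F))(ℂ)` for some nonzero admissible form `F`.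
`⇒`: `σ` is surjective (`CurveNet.surjective_blowDown`), so `σ^* c ∈ N¹` (pull-back of a class of
coniveau `≥ 2 ≥ 1` along a dominant morphism, `map_mem_supportedClasses_one_of_denseRange`), hence
`σ^* c` is algebraic (`soloInformed_mem_algebraicClasses_of_mem_supportedClasses_one`; it is rational
and of type `(2,2)` by functoriality, `preservesHodgeType_of_nonempty_hodgeModel`), hence vertically
supported. `⇐`: `σ^* c` is algebraic (`soloInformed_mem_algebraicClasses_iff_curveNetSupport`) and
`c = σ_* σ^* c` (`soloInformed_complexGysin_map_of_isBirational`, `σ` birational), with `σ_*`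
preserving algebraic classes (`map_complexGysin_algebraicClasses_le`).
[cite: Arapura2022, Cor. 1.4] [cite: Hartshorne1977, II Example 7.17.3] [cite: GrothendieckTopology1969, §1] -/
theorem soloInformed_mem_algebraicClasses_iff_curveNetSupport_map (hX : Motives.IsSmoothProjective 4 X)
    (N : CurveNet 3 X) (c : complexBetti X (2 * 2)) (hc : IsRationalClass c)
    (hc' : IsOfHodgeType 4 X (2 * 2) 2 2 c) :
    c ∈ algebraicClasses X 2 ↔
      ∃ F : MvPolynomial (Fin (3 + 1)) ℂ, N.IsAdmissibleForm F ∧ F ≠ 0 ∧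
        complexBetti.map N.blowDown (2 * 2) c ∈
          classesSupportedOn N.total (N.proj.left.base ⁻¹' projHypersurface 3 F) (2 * 2) := by
  -- `σ^* c` is rational of type `(2,2)`
  have hbc : IsRationalClass (complexBetti.map N.blowDown (2 * 2) c) :=
    hc.map (Motives.AlgPoints.mapContinuous (L := ℂ) N.blowDown)
  have hbc' : IsOfHodgeType (3 + 1) N.total (2 * 2) 2 2 (complexBetti.map N.blowDown (2 * 2) c) :=
    preservesHodgeType_of_nonempty_hodgeModel hodgePQ_independent_of_hodgeModel_holds
      nonempty_hodgeModel_holds N.isSmoothProjective_total hX N.blowDown hc'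
  rw [← soloInformed_mem_algebraicClasses_iff_curveNetSupport N _ hbc hbc']
  -- `σ` is surjective and birational
  haveI := irreducibleSpace_of_isSmoothProjective' hX
  haveI : IsProper X.hom := hX.isProjectiveOver.isProper
  have hsurj : Function.Surjective N.blowDown.left.base := N.surjective_blowDown
  have hbir : Resolution.IsBirational N.blowDown.left := by
    haveI := N.irreducibleSpace_total
    refine ⟨N.offBaseLocus, N.offBaseLocus.isOpen.dense N.offBaseLocus_nonempty, ?_,
      N.isIso_blowDown_morphismRestrict⟩
    obtain ⟨x, hx⟩ := N.offBaseLocus_nonempty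
    obtain ⟨y, hy⟩ := N.compl_baseLocus_subset_range_blowDown hx
    refine (N.blowDown.left ⁻¹ᵁ N.offBaseLocus).isOpen.dense ⟨y, ?_⟩
    show N.blowDown.left.base y ∈ (N.offBaseLocus : Set X.left)
    rw [hy]
    exact hx
  constructor
  · -- `⇒`: `σ^* c ∈ N¹`, hence algebraic
    intro h
    exact soloInformed_mem_algebraicClasses_of_mem_supportedClasses_one le_rfl
      N.isSmoothProjective_total hbc hbc'
      (map_mem_supportedClasses_one_of_denseRange N.isSmoothProjective_total hX N.blowDown
        hsurj.denseRange (2 * 2) (supportedClasses_mono X (2 * 2) (by norm_num) h))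
  · -- `⇐`: `c = σ_* σ^* c` with `σ^* c` algebraic
    intro h
    rw [← soloInformed_complexGysin_map_of_isBirational N.isSmoothProjective_total hX N.blowDown hbir
      (rfl : 2 * 2 + 2 * (3 + 1) = 2 * 2 + 2 * (3 + 1)) c]
    exact map_complexGysin_algebraicClasses_le (gysinMap_restrictCompl_eq_zero_of_field ℂ)
      complexOrientationFamily hasPoincareDuality_complexOrientationFamily N.isSmoothProjective_total
      hX N.blowDown (e := 0) rfl ⟨_, h, rfl⟩

end Summit.HodgeConjecture.HodgeConjecture.Theorems

end
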